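import Mathlib.RingTheory.PowerSeries.Evaluation
import Mathlib.RingTheory.PowerSeries.Substitution
import Mathlib.NumberTheory.Padics.PadicIntegers
import Mathlib.Analysis.SpecificLimits.Basic
import Mathlib.Analysis.Normed.Group.Ultra
import Mathlib.Analysis.Normed.Group.InfiniteSum
import HarnessLib

/-!
# `p`-adic evaluation of integral formal power series in one and two variables

Trunk T-NT-EC (Literature/NumberTheory/EllipticCurves); infrastructure behind the formal-group
dictionary `E₁(ℚ_p) ≅ Ê(pℤ_p)` (Silverman AEC IV.1, VII.2.2) and the evaluation of the
Mazur–Tate theta identity at points (`CanonicalPAdicHeightThetaProofs.lean`), i.e. behind the named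
fact `WeierstrassCurve.padicSigma_theta`.

For `f = Σ aₙ Xⁿ ∈ ℚ_p⟦X⟧` and `F = Σ a_d u^{d₀} v^{d₁} ∈ ℚ_p⟦u, v⟧` we define the `p`-adic
values `padicEval f t = Σ' aₙ tⁿ` and `padicEval₂ F u v = Σ' a_d u^{d₀} v^{d₁}` as `tsum`s in
`ℚ_p` (junk `0` off the domain of summability; this is the shape of the tree's
`WeierstrassCurve.padicSigmaEval` and `WeierstrassCurve.padicFormalLog`), and prove that on
INTEGRAL series (`IsPadicInt`: all coefficients in `ℤ_p`) evaluated at points of the open unit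
disc they are the values of Mathlib's topological evaluation `MvPowerSeries.eval₂` into the
linearly topologized complete ring `ℤ_p` (Bourbaki, *Algèbre* IV §4; Chambert-Loir–de Frutos
Fernández's Mathlib formalisation). Consequences: evaluation is a ring homomorphism
(`padicEval_mul`, `padicEval₂_mul`, …) and COMMUTES WITH SUBSTITUTION (`padicEval_subst`,
`padicEval₂_subst`, `padicEval₂_substPair`): `(f ∘ g)(t) = f(g(t))`.

## Main statements

* `padicInt_isLinearTopology` — the ideals `pⁿℤ_p` form a basis of neighbourhoods of `0`:
  `ℤ_p` is linearly topologized (the instance Mathlib's evaluation theory needs; Mathlib has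
  it only for discrete and adic topologies). A new instance on a Mathlib type, deliberately.
* `mvPowerSeries_continuous_subst`, `padicInt_eval₂_subst` — substitution is continuous for
  the product topology induced by ANY ring topology on the coefficients, hence evaluation of
  `ℤ_p`-series commutes with substitution (Mathlib's `MvPowerSeries.eval₂_subst` is stated for
  DISCRETE coefficient rings only, which `ℤ_p` with its `p`-adic topology is not).
* `padicEval_eq_coe_eval₂`, `padicEval₂_eq_coe_eval₂` — the `tsum`s are Mathlib's `eval₂`.
* the evaluation calculus listed above, and the ultrametric bounds `‖f(t)‖ ≤ 1`,
  `‖f(t)‖ ≤ ‖t‖` when `f(0) = 0`.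

## Design notes

* Everything is stated over `ℚ_p` with the side condition `IsPadicInt` (`↔ ∃ G ∈ ℤ_p⟦…⟧,
  G.map (↑) = f`, `isPadicInt_iff_exists_map`), because the consumers (`padicSigma`,
  `formalGroupLawQ`, `formalNeg`, `formalXMulSq` of `W ⊗ ℚ_p`) live over `ℚ_p`.
* Two variables are `MvPowerSeries (Fin 2) ℚ_[p]` with `u = X 0`, `v = X 1`, matching
  `WeierstrassCurve.formalGroupLawQ`.

## References

* N. Bourbaki, *Algèbre*, Ch. IV §4 no. 3 (substitution and evaluation of formal power series).
* J. H. Silverman, *The Arithmetic of Elliptic Curves*, 2nd ed., IV.1 ("the power series …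
  converge for `z ∈ 𝓜`"), IV.6, VII.2.2.
-/

noncomputable section

open Filter PowerSeries
open scoped Topology

namespace Literature.NumberTheory.EllipticCurves

/-! ### `ℤ_p` is linearly topologized; points of the open unit disc are evaluable -/

section LinearTopology

variable {p : ℕ} [Fact p.Prime]

/-- The ideals `pⁿ ℤ_p` (`n ≥ 0`) form a basis of neighbourhoods of `0` in `ℤ_p`
(`‖x‖ ≤ p⁻ⁿ ↔ x ∈ pⁿℤ_p`, Mathlib `PadicInt.norm_le_pow_iff_mem_span_pow`). [folklore] -/
theorem padicInt_hasBasis_nhds_zero :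
    (𝓝 (0 : ℤ_[p])).HasBasis (fun _ : ℕ => True)
      (fun n => ((Ideal.span {(p : ℤ_[p]) ^ n} : Ideal ℤ_[p]) : Set ℤ_[p])) := by
  have hp : (1 : ℝ) < p := by exact_mod_cast (Fact.out : p.Prime).one_lt
  refine Metric.nhds_basis_closedBall.to_hasBasis (fun ε hε => ?_) fun n _ => ?_
  · obtain ⟨n, hn⟩ : ∃ n : ℕ, (p : ℝ) ^ (-(n : ℤ)) < ε := by
      obtain ⟨n, hn⟩ := exists_pow_lt_of_lt_one hε (inv_lt_one_of_one_lt₀ hp)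
      exact ⟨n, by rwa [zpow_neg, zpow_natCast, ← inv_pow]⟩
    refine ⟨n, trivial, fun x hx => ?_⟩
    rw [SetLike.mem_coe, ← PadicInt.norm_le_pow_iff_mem_span_pow] at hx
    rw [Metric.mem_closedBall, dist_zero_right]
    exact hx.trans hn.le
  · refine ⟨(p : ℝ) ^ (-(n : ℤ)), zpow_pos (by positivity) _, fun x hx => ?_⟩
    rw [Metric.mem_closedBall, dist_zero_right] at hx
    rw [SetLike.mem_coe, ← PadicInt.norm_le_pow_iff_mem_span_pow]
    exact hx

/-- **`ℤ_p` is linearly topologized** (as a module over itself): `0` has a basis of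
neighbourhoods consisting of ideals. This is the hypothesis of Mathlib's topological evaluation
of power series (`MvPowerSeries.eval₂`, `PowerSeries.eval₂`); Mathlib provides the instance only
for discrete and adic topologies, so we register it here for the `p`-adic integers (a new
instance on a Mathlib type; compare `IsLinearTopology (unitBall L)` in
`Literature/NumberTheory/GaloisRepresentations/LubinTateTorsion.lean`). [folklore] -/
instance padicInt_isLinearTopology : IsLinearTopology ℤ_[p] ℤ_[p] :=
  IsLinearTopology.mk_of_hasBasis' ℤ_[p] padicInt_hasBasis_nhds_zero
    fun I r _ hx => I.smul_mem r hx

/-- An element of `ℤ_p` of norm `< 1` is topologically nilpotent. [folklore] -/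
theorem padicInt_tendsto_pow_of_norm_lt_one {t : ℤ_[p]} (ht : ‖t‖ < 1) :
    Tendsto (fun n : ℕ => t ^ n) atTop (𝓝 0) := by
  rw [tendsto_zero_iff_norm_tendsto_zero]
  simp_rw [norm_pow]
  exact tendsto_pow_atTop_nhds_zero_of_lt_one (norm_nonneg t) ht

/-- Points of the open unit disc of `ℤ_p` are evaluable (`PowerSeries.HasEval`). [folklore] -/
theorem padicInt_hasEval {t : ℤ_[p]} (ht : ‖t‖ < 1) : PowerSeries.HasEval t :=
  (PowerSeries.hasEval_def t).mpr (padicInt_tendsto_pow_of_norm_lt_one ht)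

/-- Finite families of points of the open unit disc of `ℤ_p` are evaluable
(`MvPowerSeries.HasEval`). [folklore] -/
theorem padicInt_mvHasEval {τ : Type*} [Finite τ] {b : τ → ℤ_[p]} (hb : ∀ i, ‖b i‖ < 1) :
    MvPowerSeries.HasEval b where
  hpow i := padicInt_tendsto_pow_of_norm_lt_one (hb i)
  tendsto_zero := by
    rw [(Filter.cofinite_eq_bot_iff.mpr ‹Finite τ›)]
    exact tendsto_bot

/-- The pair `(u, v)` of points of the open unit disc, as an evaluable family on `Fin 2`.
[folklore] -/
theorem padicInt_hasEval_pair {u v : ℤ_[p]} (hu : ‖u‖ < 1) (hv : ‖v‖ < 1) :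
    MvPowerSeries.HasEval ![u, v] :=
  padicInt_mvHasEval fun i => by fin_cases i <;> assumption

end LinearTopology

/-! ### Substitution is continuous for any coefficient topology; evaluation of `ℤ_p`-series
commutes with substitution -/

section SubstCompat

open MvPowerSeries MvPowerSeries.WithPiTopology

variable {σ τ : Type*}

/-- For `HasSubst a`, the set of exponents `d` for which `∏ₛ (a s)^{d s}` has a non-zero `e`-th
coefficient is FINITE — uniformly in the series being substituted (apply Mathlib's
`coeff_subst_finite` to the series all of whose coefficients are `1`). [folklore] -/
theorem mvPowerSeries_finite_support_coeff_prod_pow {R : Type*} [CommRing R]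
    {a : σ → MvPowerSeries τ R} (ha : HasSubst a) (e : τ →₀ ℕ) :
    (Function.support fun d : σ →₀ ℕ => coeff e (d.prod fun s n => a s ^ n)).Finite := by
  have h := coeff_subst_finite ha (fun _ => (1 : R) : MvPowerSeries σ R) e
  refine h.subset fun d hd => ?_
  simp only [Function.mem_support, ne_eq] at hd ⊢
  rwa [show coeff d (fun _ => (1 : R) : MvPowerSeries σ R) = 1 from rfl, one_smul]

/-- The `e`-th coefficient of `subst a f` as a finite sum over a set of exponents independent
of `f`. [folklore] -/
theorem mvPowerSeries_coeff_subst_eq_sum {R : Type*} [CommRing R] {a : σ → MvPowerSeries τ R}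
    (ha : HasSubst a) (f : MvPowerSeries σ R) (e : τ →₀ ℕ) :
    coeff e (subst a f) = ∑ d ∈ (mvPowerSeries_finite_support_coeff_prod_pow ha e).toFinset,
      coeff d f * coeff e (d.prod fun s n => a s ^ n) := by
  rw [coeff_subst ha]
  simp_rw [smul_eq_mul]
  apply finsum_eq_sum_of_support_subset
  intro d hd
  simp only [Function.mem_support, ne_eq, Set.Finite.coe_toFinset] at hd ⊢
  exact fun h0 => hd (by rw [h0, mul_zero])

/-- **Substitution is continuous** for the product topology on power series induced by ANY ring
topology on the coefficients: each coefficient of `subst a f` is a fixed finite combination of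
coefficients of `f`. (Mathlib's `MvPowerSeries.continuous_subst` is the discrete case.)
[Bourbaki, Algèbre IV §4 no. 3] [folklore] -/
theorem mvPowerSeries_continuous_subst {R : Type*} [CommRing R] [TopologicalSpace R]
    [IsTopologicalRing R] {a : σ → MvPowerSeries τ R} (ha : HasSubst a) :
    Continuous (subst a : MvPowerSeries σ R → MvPowerSeries τ R) := by
  refine continuous_pi fun e => ?_
  have : (fun f : MvPowerSeries σ R => (subst a f) e) = fun f =>
      ∑ d ∈ (mvPowerSeries_finite_support_coeff_prod_pow ha e).toFinset,
        coeff d f * coeff e (d.prod fun s n => a s ^ n) := by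
    funext f; exact mvPowerSeries_coeff_subst_eq_sum ha f e
  rw [this]
  exact continuous_finsetSum _ fun d _ => (continuous_apply d).mul continuous_const

variable {p : ℕ} [Fact p.Prime] {a : σ → MvPowerSeries τ ℤ_[p]} {b : τ → ℤ_[p]}

/-- **Evaluation commutes with substitution** for power series with coefficients in `ℤ_p`
(`p`-adic topology): `(subst a f)(b) = f(a(b))`. Proof: both sides are continuous in `f` and
agree on polynomials (Mathlib's `eval₂_unique`). [Bourbaki, Algèbre IV §4 no. 3, Prop. 4]
[folklore] -/
theorem padicInt_eval₂_subst (ha : HasSubst a) (hb : MvPowerSeries.HasEval b)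
    (f : MvPowerSeries σ ℤ_[p]) :
    eval₂ (RingHom.id ℤ_[p]) b (subst a f) =
      eval₂ (RingHom.id ℤ_[p]) (fun s => eval₂ (RingHom.id ℤ_[p]) b (a s)) f := by
  have hc : Continuous (eval₂Hom (φ := RingHom.id ℤ_[p]) continuous_id hb) := by
    rw [MvPowerSeries.coe_eval₂Hom]
    exact continuous_eval₂ (φ := RingHom.id ℤ_[p]) continuous_id hb
  have hb' : MvPowerSeries.HasEval fun s => eval₂ (RingHom.id ℤ_[p]) b (a s) := by
    have := (ha.hasEval (S := ℤ_[p])).map hc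
    rwa [MvPowerSeries.coe_eval₂Hom] at this
  have key := eval₂_unique (φ := RingHom.id ℤ_[p]) continuous_id hb'
    (ε := fun f => eval₂ (RingHom.id ℤ_[p]) b (subst a f))
    ((continuous_eval₂ (φ := RingHom.id ℤ_[p]) continuous_id hb).comp
      (mvPowerSeries_continuous_subst ha)) ?_
  · exact congr_fun key f
  · intro q
    rw [MvPowerSeries.subst_coe]
    induction q using MvPolynomial.induction_on with
    | C r =>
      rw [MvPolynomial.aeval_C, MvPolynomial.eval₂_C, MvPowerSeries.algebraMap_apply,
        Algebra.algebraMap_self,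
        MvPowerSeries.eval₂_C, RingHom.id_apply]
    | add f g hf hg =>
      rw [map_add, MvPolynomial.eval₂_add, ← hf, ← hg, ← MvPowerSeries.coe_eval₂Hom continuous_id hb,
        map_add]
    | mul_X f s hf =>
      rw [map_mul, MvPolynomial.aeval_X, MvPolynomial.eval₂_mul, MvPolynomial.eval₂_X, ← hf,
        ← MvPowerSeries.coe_eval₂Hom continuous_id hb, map_mul]

/-- The one-variable case: `(f.subst a)(b) = f(a(b))` for `f ∈ ℤ_p⟦X⟧` substituted with a
multivariate `a`. [folklore] -/
theorem padicInt_eval₂_powerSeries_subst {a : MvPowerSeries τ ℤ_[p]}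
    (ha : PowerSeries.HasSubst a) (hb : MvPowerSeries.HasEval b) (f : ℤ_[p]⟦X⟧) :
    eval₂ (RingHom.id ℤ_[p]) b (f.subst a) =
      PowerSeries.eval₂ (RingHom.id ℤ_[p]) (eval₂ (RingHom.id ℤ_[p]) b a) f :=
  padicInt_eval₂_subst (PowerSeries.HasSubst.const ha) hb f

end SubstCompat

/-! ### Integral series over `ℚ_p` -/

section Integral

variable {p : ℕ} [Fact p.Prime] {σ : Type*}

/-- `F ∈ ℤ_p⟦σ⟧ ⊂ ℚ_p⟦σ⟧`: every coefficient has norm `≤ 1`. [folklore] -/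
def IsPadicInt (F : MvPowerSeries σ ℚ_[p]) : Prop :=
  ∀ d, ‖MvPowerSeries.coeff d F‖ ≤ 1

/-- The integral model of an integral series. [folklore] -/
def toPadicInt (F : MvPowerSeries σ ℚ_[p]) (hF : IsPadicInt F) : MvPowerSeries σ ℤ_[p] :=
  fun d => ⟨MvPowerSeries.coeff d F, hF d⟩

/-- Coefficients of the integral model. [folklore] -/
@[simp] theorem coeff_toPadicInt (F : MvPowerSeries σ ℚ_[p]) (hF : IsPadicInt F) (d : σ →₀ ℕ) :
    ((MvPowerSeries.coeff d (toPadicInt F hF) : ℤ_[p]) : ℚ_[p]) = MvPowerSeries.coeff d F := rfl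

/-- `toPadicInt F ↦ F` under the coefficientwise inclusion `ℤ_p ⊂ ℚ_p`. [folklore] -/
@[simp] theorem map_toPadicInt (F : MvPowerSeries σ ℚ_[p]) (hF : IsPadicInt F) :
    (toPadicInt F hF).map PadicInt.Coe.ringHom = F := by
  ext d; simp

/-- Series mapped from `ℤ_p⟦σ⟧` are integral. [folklore] -/
theorem isPadicInt_map (G : MvPowerSeries σ ℤ_[p]) : IsPadicInt (G.map PadicInt.Coe.ringHom) :=
  fun d => by rw [MvPowerSeries.coeff_map]; exact PadicInt.norm_le_one _

/-- `F` is integral iff it comes from `ℤ_p⟦σ⟧`. [folklore] -/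
theorem isPadicInt_iff_exists_map {F : MvPowerSeries σ ℚ_[p]} :
    IsPadicInt F ↔ ∃ G : MvPowerSeries σ ℤ_[p], G.map PadicInt.Coe.ringHom = F :=
  ⟨fun h => ⟨toPadicInt F h, map_toPadicInt F h⟩, fun ⟨G, hG⟩ => hG ▸ isPadicInt_map G⟩

/-- One-variable form: `f` is integral iff it comes from `ℤ_p⟦X⟧`. [folklore] -/
theorem isPadicInt_iff_exists_powerSeries_map {f : ℚ_[p]⟦X⟧} :
    IsPadicInt f ↔ ∃ G : ℤ_[p]⟦X⟧, G.map PadicInt.Coe.ringHom = f :=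
  isPadicInt_iff_exists_map

/-- One-variable form of the definition. [folklore] -/
theorem isPadicInt_iff_coeff {f : ℚ_[p]⟦X⟧} : IsPadicInt f ↔ ∀ n, ‖coeff n f‖ ≤ 1 := by
  refine ⟨fun h n => h _, fun h d => ?_⟩
  have : d = Finsupp.single () (d ()) := by ext; simp
  rw [this]; exact h (d ())

/-- Sums of integral series are integral. [folklore] -/
theorem IsPadicInt.add {F G : MvPowerSeries σ ℚ_[p]} (hF : IsPadicInt F) (hG : IsPadicInt G) :
    IsPadicInt (F + G) := by
  obtain ⟨F', rfl⟩ := isPadicInt_iff_exists_map.mp hF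
  obtain ⟨G', rfl⟩ := isPadicInt_iff_exists_map.mp hG
  rw [← map_add]; exact isPadicInt_map _

/-- Negatives of integral series are integral. [folklore] -/
theorem IsPadicInt.neg {F : MvPowerSeries σ ℚ_[p]} (hF : IsPadicInt F) : IsPadicInt (-F) := by
  obtain ⟨F', rfl⟩ := isPadicInt_iff_exists_map.mp hF
  rw [← map_neg]; exact isPadicInt_map _

/-- Differences of integral series are integral. [folklore] -/
theorem IsPadicInt.sub {F G : MvPowerSeries σ ℚ_[p]} (hF : IsPadicInt F) (hG : IsPadicInt G) :
    IsPadicInt (F - G) := by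
  rw [sub_eq_add_neg]; exact hF.add hG.neg

/-- Products of integral series are integral. [folklore] -/
theorem IsPadicInt.mul {F G : MvPowerSeries σ ℚ_[p]} (hF : IsPadicInt F) (hG : IsPadicInt G) :
    IsPadicInt (F * G) := by
  obtain ⟨F', rfl⟩ := isPadicInt_iff_exists_map.mp hF
  obtain ⟨G', rfl⟩ := isPadicInt_iff_exists_map.mp hG
  rw [← map_mul]; exact isPadicInt_map _

/-- Powers of integral series are integral. [folklore] -/
theorem IsPadicInt.pow {F : MvPowerSeries σ ℚ_[p]} (hF : IsPadicInt F) (n : ℕ) :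
    IsPadicInt (F ^ n) := by
  obtain ⟨F', rfl⟩ := isPadicInt_iff_exists_map.mp hF
  rw [← map_pow]; exact isPadicInt_map _

/-- `1` is integral. [folklore] -/
theorem IsPadicInt.one : IsPadicInt (1 : MvPowerSeries σ ℚ_[p]) := by
  rw [← map_one (MvPowerSeries.map (σ := σ) PadicInt.Coe.ringHom)]; exact isPadicInt_map _

/-- `0` is integral. [folklore] -/
theorem IsPadicInt.zero : IsPadicInt (0 : MvPowerSeries σ ℚ_[p]) := fun d => by simp

/-- The variables are integral. [folklore] -/
theorem IsPadicInt.X (i : σ) : IsPadicInt (MvPowerSeries.X i : MvPowerSeries σ ℚ_[p]) := by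
  rw [← MvPowerSeries.map_X PadicInt.Coe.ringHom i]; exact isPadicInt_map _

/-- The variable `X ∈ ℚ_p⟦X⟧` is integral. [folklore] -/
theorem IsPadicInt.powerSeries_X : IsPadicInt (PowerSeries.X : ℚ_[p]⟦X⟧) := by
  rw [← PowerSeries.map_X PadicInt.Coe.ringHom]; exact isPadicInt_map _

/-- Constants of norm `≤ 1` are integral. [folklore] -/
theorem IsPadicInt.C {c : ℚ_[p]} (hc : ‖c‖ ≤ 1) :
    IsPadicInt (MvPowerSeries.C c : MvPowerSeries σ ℚ_[p]) := by
  have : MvPowerSeries.C c = (MvPowerSeries.C (⟨c, hc⟩ : ℤ_[p]) :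
      MvPowerSeries σ ℤ_[p]).map PadicInt.Coe.ringHom := by
    rw [MvPowerSeries.map_C]; rfl
  rw [this]; exact isPadicInt_map _

/-- In `ℚ_p⟦τ⟧` (reduced coefficients) `HasSubst` forces a ZERO constant coefficient.
[folklore] -/
theorem constantCoeff_eq_zero_of_hasSubst {τ : Type*} {a : σ → MvPowerSeries τ ℚ_[p]}
    (h : MvPowerSeries.HasSubst a) (s : σ) : MvPowerSeries.constantCoeff (a s) = 0 :=
  (h.const_coeff s).eq_zero

/-- `HasSubst` descends to the integral models (the inclusion `ℤ_p ⊂ ℚ_p` is injective).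
[folklore] -/
theorem hasSubst_toPadicInt {τ : Type*} {a : σ → MvPowerSeries τ ℚ_[p]}
    (ha : ∀ s, IsPadicInt (a s)) (h : MvPowerSeries.HasSubst a) :
    MvPowerSeries.HasSubst fun s => toPadicInt (a s) (ha s) := by
  refine ⟨fun s => ?_, fun d => ?_⟩
  · have h0 : MvPowerSeries.constantCoeff (toPadicInt (a s) (ha s)) = 0 := by
      apply PadicInt.coe_eq_zero.mp
      rw [← MvPowerSeries.coeff_zero_eq_constantCoeff_apply, coeff_toPadicInt,
        MvPowerSeries.coeff_zero_eq_constantCoeff_apply]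
      exact constantCoeff_eq_zero_of_hasSubst h s
    rw [h0]; exact IsNilpotent.zero
  · refine (h.coeff_zero d).subset fun s hs => ?_
    simp only [ne_eq, Set.mem_setOf_eq] at hs ⊢
    intro h0
    apply hs
    exact PadicInt.coe_eq_zero.mp (by rw [coeff_toPadicInt]; exact h0)

/-- Substituting integral series into an integral series gives an integral series
(`MvPowerSeries.map_subst`). [folklore] -/
theorem IsPadicInt.subst {τ : Type*} {F : MvPowerSeries σ ℚ_[p]}
    {a : σ → MvPowerSeries τ ℚ_[p]} (hF : IsPadicInt F) (ha : ∀ s, IsPadicInt (a s))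
    (h : MvPowerSeries.HasSubst a) : IsPadicInt (MvPowerSeries.subst a F) := by
  have key := MvPowerSeries.map_subst (hasSubst_toPadicInt ha h) (h := PadicInt.Coe.ringHom)
    (toPadicInt F hF)
  simp only [map_toPadicInt] at key
  rw [← key]; exact isPadicInt_map _

/-- One-variable substitution: `f.subst a` is integral for `f ∈ ℤ_p⟦X⟧`, `a` integral with
`HasSubst`. [folklore] -/
theorem IsPadicInt.powerSeries_subst {τ : Type*} {f : ℚ_[p]⟦X⟧} {a : MvPowerSeries τ ℚ_[p]}
    (hf : IsPadicInt f) (ha : IsPadicInt a) (h : PowerSeries.HasSubst a) :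
    IsPadicInt (f.subst a) :=
  IsPadicInt.subst hf (fun _ => ha) (PowerSeries.HasSubst.const h)

end Integral

/-! ### `p`-adic evaluation: definitions and the bridge to Mathlib's `eval₂` -/

section Eval

variable {p : ℕ} [Fact p.Prime]

/-- **`f(t) = Σ' aₙ tⁿ ∈ ℚ_p`** for `f = Σ aₙ Xⁿ ∈ ℚ_p⟦X⟧` and `t ∈ ℚ_p` (a `tsum`, junk `0` where
the series is not summable; for `f` integral and `‖t‖ < 1` it is Mathlib's topological
evaluation, `padicEval_eq_coe_eval₂`). [Silverman AEC IV.1, IV.6] [folklore] -/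
def padicEval (f : ℚ_[p]⟦X⟧) (t : ℚ_[p]) : ℚ_[p] :=
  ∑' n : ℕ, coeff n f * t ^ n

/-- **`F(u, v) = Σ' a_d u^{d₀} v^{d₁} ∈ ℚ_p`** for `F ∈ ℚ_p⟦X₀, X₁⟧` (a `tsum` over `Fin 2 →₀ ℕ`,
junk `0` off the domain of summability). [Silverman AEC IV.1 ("the power series formally
giving the addition law … converge")] [folklore] -/
def padicEval₂ (F : MvPowerSeries (Fin 2) ℚ_[p]) (u v : ℚ_[p]) : ℚ_[p] :=
  ∑' d : Fin 2 →₀ ℕ, MvPowerSeries.coeff d F * (u ^ d 0 * v ^ d 1)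

/-- The monomial `∏ₛ bₛ^{d s}` on `Fin 2` is `b₀^{d 0} b₁^{d 1}`. [folklore] -/
theorem finsupp_prod_pow_fin_two {R : Type*} [CommMonoid R] (d : Fin 2 →₀ ℕ) (b : Fin 2 → R) :
    (d.prod fun s e => b s ^ e) = b 0 ^ d 0 * b 1 ^ d 1 := by
  rw [Finsupp.prod_fintype _ _ fun i => pow_zero _, Fin.prod_univ_two]

/-- The coefficientwise inclusion is compatible with the `n`-th coefficient. [folklore] -/
theorem coeff_map_coe (G : ℤ_[p]⟦X⟧) (n : ℕ) :
    coeff n (G.map PadicInt.Coe.ringHom) = ((coeff n G : ℤ_[p]) : ℚ_[p]) := by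
  rw [PowerSeries.coeff_map]; rfl

/-- The same for multivariate series. [folklore] -/
theorem mvCoeff_map_coe {σ : Type*} (G : MvPowerSeries σ ℤ_[p]) (d : σ →₀ ℕ) :
    MvPowerSeries.coeff d (G.map PadicInt.Coe.ringHom) =
      ((MvPowerSeries.coeff d G : ℤ_[p]) : ℚ_[p]) := by
  rw [MvPowerSeries.coeff_map]; rfl

/-- **Bridge, one variable**: for `G ∈ ℤ_p⟦X⟧` and `‖t‖ < 1`, the `tsum` `padicEval` is Mathlib's
`PowerSeries.eval₂` into `ℤ_p`. [folklore] -/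
theorem padicEval_eq_coe_eval₂ (G : ℤ_[p]⟦X⟧) {t : ℤ_[p]} (ht : ‖t‖ < 1) :
    padicEval (G.map PadicInt.Coe.ringHom) t =
      (PowerSeries.eval₂ (RingHom.id ℤ_[p]) t G : ℤ_[p]) := by
  have h := PowerSeries.hasSum_eval₂ (φ := RingHom.id ℤ_[p]) continuous_id (padicInt_hasEval ht) G
  have h' := h.map PadicInt.Coe.ringHom.toAddMonoidHom continuous_subtype_val
  unfold padicEval
  have hf : (fun n => coeff n (G.map PadicInt.Coe.ringHom) * (t : ℚ_[p]) ^ n) =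
      (⇑PadicInt.Coe.ringHom.toAddMonoidHom ∘ fun d => (RingHom.id ℤ_[p]) (coeff d G) * t ^ d) := by
    funext n; simp
  rw [hf, h'.tsum_eq]; rfl


/-- **Bridge, two variables**: for `G ∈ ℤ_p⟦X₀, X₁⟧` and `‖u‖, ‖v‖ < 1`, `padicEval₂` is Mathlib's
`MvPowerSeries.eval₂` at `![u, v]`. [folklore] -/
theorem padicEval₂_eq_coe_eval₂ (G : MvPowerSeries (Fin 2) ℤ_[p]) {u v : ℤ_[p]} (hu : ‖u‖ < 1)
    (hv : ‖v‖ < 1) :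
    padicEval₂ (G.map PadicInt.Coe.ringHom) u v =
      (MvPowerSeries.eval₂ (RingHom.id ℤ_[p]) ![u, v] G : ℤ_[p]) := by
  have h := MvPowerSeries.hasSum_eval₂ (φ := RingHom.id ℤ_[p]) continuous_id
    (padicInt_hasEval_pair hu hv) G
  have h' := h.map PadicInt.Coe.ringHom.toAddMonoidHom continuous_subtype_val
  unfold padicEval₂
  have hf : (fun d : Fin 2 →₀ ℕ => MvPowerSeries.coeff d (G.map PadicInt.Coe.ringHom) *
      ((u : ℚ_[p]) ^ d 0 * (v : ℚ_[p]) ^ d 1)) =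
      (⇑PadicInt.Coe.ringHom.toAddMonoidHom ∘ fun d =>
        (RingHom.id ℤ_[p]) (MvPowerSeries.coeff d G) * d.prod fun s e => ![u, v] s ^ e) := by
    funext d; simp
  rw [hf, h'.tsum_eq]; rfl

/-! ### The evaluation homomorphisms on `ℤ_p`-series -/

/-- Mathlib's evaluation of `ℤ_p⟦X⟧` at a point `t` of the open unit disc, as a ring
homomorphism `ℤ_p⟦X⟧ →+* ℤ_p`. [folklore] -/
abbrev evalHom (t : ℤ_[p]) (ht : ‖t‖ < 1) : ℤ_[p]⟦X⟧ →+* ℤ_[p] :=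
  PowerSeries.eval₂Hom (φ := RingHom.id ℤ_[p]) continuous_id (padicInt_hasEval ht)

/-- Mathlib's evaluation of `ℤ_p⟦X₀, X₁⟧` at a pair of points of the open unit disc, as a ring
homomorphism. [folklore] -/
abbrev evalHom₂ (u v : ℤ_[p]) (hu : ‖u‖ < 1) (hv : ‖v‖ < 1) :
    MvPowerSeries (Fin 2) ℤ_[p] →+* ℤ_[p] :=
  MvPowerSeries.eval₂Hom (φ := RingHom.id ℤ_[p]) continuous_id (padicInt_hasEval_pair hu hv)

/-- `evalHom` is Mathlib's `PowerSeries.eval₂`. [folklore] -/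
theorem evalHom_apply (t : ℤ_[p]) (ht : ‖t‖ < 1) (G : ℤ_[p]⟦X⟧) :
    evalHom t ht G = PowerSeries.eval₂ (RingHom.id ℤ_[p]) t G := by
  rw [evalHom, PowerSeries.coe_eval₂Hom]

/-- `evalHom₂` is Mathlib's `MvPowerSeries.eval₂`. [folklore] -/
theorem evalHom₂_apply (u v : ℤ_[p]) (hu : ‖u‖ < 1) (hv : ‖v‖ < 1)
    (G : MvPowerSeries (Fin 2) ℤ_[p]) :
    evalHom₂ u v hu hv G = MvPowerSeries.eval₂ (RingHom.id ℤ_[p]) ![u, v] G := by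
  rw [evalHom₂, MvPowerSeries.coe_eval₂Hom]

/-- Bridge in hom form, one variable. [folklore] -/
theorem padicEval_map (G : ℤ_[p]⟦X⟧) {t : ℤ_[p]} (ht : ‖t‖ < 1) :
    padicEval (G.map PadicInt.Coe.ringHom) t = (evalHom t ht G : ℤ_[p]) := by
  rw [evalHom_apply]; exact padicEval_eq_coe_eval₂ G ht

/-- Bridge in hom form, two variables. [folklore] -/
theorem padicEval₂_map (G : MvPowerSeries (Fin 2) ℤ_[p]) {u v : ℤ_[p]} (hu : ‖u‖ < 1)
    (hv : ‖v‖ < 1) :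
    padicEval₂ (G.map PadicInt.Coe.ringHom) u v = (evalHom₂ u v hu hv G : ℤ_[p]) := by
  rw [evalHom₂_apply]; exact padicEval₂_eq_coe_eval₂ G hu hv

/-- A point of the open unit disc of `ℚ_p` is (the image of) a point of the open unit disc of
`ℤ_p`. [folklore] -/
theorem exists_coe_eq_of_norm_lt_one {t : ℚ_[p]} (ht : ‖t‖ < 1) :
    ∃ t' : ℤ_[p], (t' : ℚ_[p]) = t ∧ ‖t'‖ < 1 :=
  ⟨⟨t, ht.le⟩, rfl, ht⟩

/-- `map` commutes with one-variable substitution (Mathlib's `PowerSeries.map_subst`, restated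
with `PowerSeries.map` on the substituted series). [folklore] -/
theorem powerSeries_map_subst {R S : Type*} [CommRing R] [CommRing S] {G : R⟦X⟧}
    (hG : PowerSeries.HasSubst G) (h : R →+* S) (F : R⟦X⟧) :
    PowerSeries.map h (F.subst G : R⟦X⟧) = (PowerSeries.map h F).subst (PowerSeries.map h G) :=
  PowerSeries.map_subst hG F

/-! ### Evaluation calculus, one variable -/

section OneVar

variable {f g : ℚ_[p]⟦X⟧} {t : ℚ_[p]}

/-- `X(t) = t`. [folklore] -/
@[simp] theorem padicEval_X (t : ℚ_[p]) : padicEval (PowerSeries.X : ℚ_[p]⟦X⟧) t = t := by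
  unfold padicEval
  rw [tsum_eq_single 1 fun n hn => by rw [coeff_X, if_neg hn, zero_mul]]
  simp

/-- `(C c)(t) = c`. [folklore] -/
@[simp] theorem padicEval_C (c t : ℚ_[p]) : padicEval (PowerSeries.C c) t = c := by
  unfold padicEval
  rw [tsum_eq_single 0 fun n hn => by rw [coeff_C, if_neg hn, zero_mul]]
  simp

/-- `f(0) = f₀`. [folklore] -/
@[simp] theorem padicEval_zero_right (f : ℚ_[p]⟦X⟧) : padicEval f 0 = constantCoeff f := by
  unfold padicEval
  rw [tsum_eq_single 0 fun n hn => by rw [zero_pow hn, mul_zero]]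
  simp

/-- The series defining `f(t)` is summable for `f` integral and `‖t‖ < 1`. [folklore] -/
theorem summable_padicEval (hf : IsPadicInt f) (ht : ‖t‖ < 1) :
    Summable fun n : ℕ => coeff n f * t ^ n := by
  refine Summable.of_norm_bounded (summable_geometric_of_lt_one (norm_nonneg t) ht) fun n => ?_
  rw [norm_mul, norm_pow]
  exact mul_le_of_le_one_left (pow_nonneg (norm_nonneg t) n) (isPadicInt_iff_coeff.mp hf n)

/-- `f(t)` is the sum of its series (integral `f`, `‖t‖ < 1`). [folklore] -/
theorem hasSum_padicEval (hf : IsPadicInt f) (ht : ‖t‖ < 1) :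
    HasSum (fun n : ℕ => coeff n f * t ^ n) (padicEval f t) :=
  (summable_padicEval hf ht).hasSum

/-- **`‖f(t)‖ ≤ 1`** for `f` integral and `‖t‖ < 1`. [folklore] -/
theorem norm_padicEval_le_one (hf : IsPadicInt f) (ht : ‖t‖ < 1) : ‖padicEval f t‖ ≤ 1 := by
  obtain ⟨F, rfl⟩ := isPadicInt_iff_exists_powerSeries_map.mp hf
  obtain ⟨t, rfl, ht'⟩ := exists_coe_eq_of_norm_lt_one ht
  rw [padicEval_map F ht']; exact PadicInt.norm_le_one _

/-- **`‖f(t)‖ ≤ ‖t‖`** for `f` integral WITHOUT CONSTANT TERM and `‖t‖ < 1` (every term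
`aₙ tⁿ`, `n ≥ 1`, has norm `≤ ‖t‖`; ultrametric inequality). [folklore] -/
theorem norm_padicEval_le (hf : IsPadicInt f) (hf0 : constantCoeff f = 0) (ht : ‖t‖ < 1) :
    ‖padicEval f t‖ ≤ ‖t‖ := by
  unfold padicEval
  refine IsUltrametricDist.norm_tsum_le_of_forall_le_of_nonneg (norm_nonneg t) fun n => ?_
  rcases n with _ | n
  · simp [hf0]
  · rw [norm_mul, norm_pow, pow_succ]
    calc ‖coeff (n + 1) f‖ * (‖t‖ ^ n * ‖t‖) ≤ 1 * (1 * ‖t‖) := by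
          gcongr
          · exact isPadicInt_iff_coeff.mp hf _
          · exact pow_le_one₀ (norm_nonneg t) ht.le
      _ = ‖t‖ := by ring

/-- In particular `‖f(t)‖ < 1`, so `f(t)` is again in the open unit disc. [folklore] -/
theorem norm_padicEval_lt_one (hf : IsPadicInt f) (hf0 : constantCoeff f = 0) (ht : ‖t‖ < 1) :
    ‖padicEval f t‖ < 1 :=
  (norm_padicEval_le hf hf0 ht).trans_lt ht

/-- `(f + g)(t) = f(t) + g(t)` (integral `f, g`, `‖t‖ < 1`). [folklore] -/
theorem padicEval_add (hf : IsPadicInt f) (hg : IsPadicInt g) (ht : ‖t‖ < 1) :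
    padicEval (f + g) t = padicEval f t + padicEval g t := by
  obtain ⟨F, rfl⟩ := isPadicInt_iff_exists_powerSeries_map.mp hf
  obtain ⟨G, rfl⟩ := isPadicInt_iff_exists_powerSeries_map.mp hg
  obtain ⟨t, rfl, ht'⟩ := exists_coe_eq_of_norm_lt_one ht
  rw [← map_add, padicEval_map _ ht', padicEval_map _ ht', padicEval_map _ ht', map_add,
    PadicInt.coe_add]

/-- `(-f)(t) = -f(t)`. [folklore] -/
theorem padicEval_neg (hf : IsPadicInt f) (ht : ‖t‖ < 1) : padicEval (-f) t = -padicEval f t := by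
  obtain ⟨F, rfl⟩ := isPadicInt_iff_exists_powerSeries_map.mp hf
  obtain ⟨t, rfl, ht'⟩ := exists_coe_eq_of_norm_lt_one ht
  rw [← map_neg, padicEval_map _ ht', padicEval_map _ ht', map_neg, PadicInt.coe_neg]

/-- `(f - g)(t) = f(t) - g(t)`. [folklore] -/
theorem padicEval_sub (hf : IsPadicInt f) (hg : IsPadicInt g) (ht : ‖t‖ < 1) :
    padicEval (f - g) t = padicEval f t - padicEval g t := by
  rw [sub_eq_add_neg, padicEval_add hf hg.neg ht, padicEval_neg hg ht, sub_eq_add_neg]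

/-- **`(f g)(t) = f(t) g(t)`** (integral `f, g`, `‖t‖ < 1`; Cauchy product). [folklore] -/
theorem padicEval_mul (hf : IsPadicInt f) (hg : IsPadicInt g) (ht : ‖t‖ < 1) :
    padicEval (f * g) t = padicEval f t * padicEval g t := by
  obtain ⟨F, rfl⟩ := isPadicInt_iff_exists_powerSeries_map.mp hf
  obtain ⟨G, rfl⟩ := isPadicInt_iff_exists_powerSeries_map.mp hg
  obtain ⟨t, rfl, ht'⟩ := exists_coe_eq_of_norm_lt_one ht
  rw [← map_mul, padicEval_map _ ht', padicEval_map _ ht', padicEval_map _ ht', map_mul,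
    PadicInt.coe_mul]

/-- `(fⁿ)(t) = f(t)ⁿ`. [folklore] -/
theorem padicEval_pow (hf : IsPadicInt f) (ht : ‖t‖ < 1) (n : ℕ) :
    padicEval (f ^ n) t = padicEval f t ^ n := by
  obtain ⟨F, rfl⟩ := isPadicInt_iff_exists_powerSeries_map.mp hf
  obtain ⟨t, rfl, ht'⟩ := exists_coe_eq_of_norm_lt_one ht
  rw [← map_pow, padicEval_map _ ht', padicEval_map _ ht', map_pow, PadicInt.coe_pow]

/-- `1(t) = 1`. [folklore] -/
theorem padicEval_one (t : ℚ_[p]) : padicEval (1 : ℚ_[p]⟦X⟧) t = 1 := by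
  rw [← map_one PowerSeries.C, padicEval_C]

/-- Inverses evaluate to inverses: if `f · g = 1` with `f, g` integral then `g(t) = f(t)⁻¹`
(`‖t‖ < 1`; e.g. `g = invOfUnit f u`). [folklore] -/
theorem padicEval_eq_inv_of_mul_eq_one (hf : IsPadicInt f) (hg : IsPadicInt g) (hfg : f * g = 1)
    (ht : ‖t‖ < 1) : padicEval g t = (padicEval f t)⁻¹ := by
  have h := padicEval_mul hf hg ht
  rw [hfg, padicEval_one] at h
  exact (eq_inv_of_mul_eq_one_right h.symm)

/-- **Evaluation commutes with substitution, one variable**: `(f ∘ g)(t) = f(g(t))` for `f, g`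
integral, `g(0) = 0`, `‖t‖ < 1`. [Bourbaki, Algèbre IV §4 no. 3] [folklore] -/
theorem padicEval_subst (hf : IsPadicInt f) (hg : IsPadicInt g) (hg0 : constantCoeff g = 0)
    (ht : ‖t‖ < 1) : padicEval (f.subst g) t = padicEval f (padicEval g t) := by
  have hgt : ‖padicEval g t‖ < 1 := norm_padicEval_lt_one hg hg0 ht
  obtain ⟨F, rfl⟩ := isPadicInt_iff_exists_powerSeries_map.mp hf
  obtain ⟨G, rfl⟩ := isPadicInt_iff_exists_powerSeries_map.mp hg
  obtain ⟨t, rfl, ht'⟩ := exists_coe_eq_of_norm_lt_one ht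
  have hG0 : constantCoeff G = 0 := by
    apply PadicInt.coe_eq_zero.mp
    rw [← coeff_zero_eq_constantCoeff_apply, ← coeff_map_coe, coeff_zero_eq_constantCoeff_apply]
    exact hg0
  have hGs : PowerSeries.HasSubst G := PowerSeries.HasSubst.of_constantCoeff_zero' hG0
  rw [padicEval_map G ht'] at hgt ⊢
  rw [← powerSeries_map_subst hGs, padicEval_map _ ht', padicEval_map _ hgt]
  simp only [evalHom_apply]
  congr 1
  exact padicInt_eval₂_powerSeries_subst hGs (PowerSeries.hasEval (padicInt_hasEval ht')) F

end OneVar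

/-! ### Evaluation calculus, two variables -/

section TwoVar

variable {F G : MvPowerSeries (Fin 2) ℚ_[p]} {f : ℚ_[p]⟦X⟧} {u v : ℚ_[p]}

/-- `X₀(u, v) = u`, `X₁(u, v) = v`. [folklore] -/
@[simp] theorem padicEval₂_X (i : Fin 2) (u v : ℚ_[p]) :
    padicEval₂ (MvPowerSeries.X i : MvPowerSeries (Fin 2) ℚ_[p]) u v = ![u, v] i := by
  classical
  unfold padicEval₂
  rw [tsum_eq_single (Finsupp.single i 1) fun d hd => by
    rw [MvPowerSeries.coeff_X, if_neg hd, zero_mul]]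
  rw [MvPowerSeries.coeff_X, if_pos rfl, one_mul]
  fin_cases i <;> simp

/-- `(C c)(u, v) = c`. [folklore] -/
@[simp] theorem padicEval₂_C (c u v : ℚ_[p]) :
    padicEval₂ (MvPowerSeries.C c : MvPowerSeries (Fin 2) ℚ_[p]) u v = c := by
  classical
  unfold padicEval₂
  rw [tsum_eq_single 0 fun d hd => by rw [MvPowerSeries.coeff_C, if_neg hd, zero_mul]]
  simp

/-- A common radius `r < 1` for the pair. [folklore] -/
theorem exists_radius_lt_one (hu : ‖u‖ < 1) (hv : ‖v‖ < 1) :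
    ∃ r : ℝ, 0 ≤ r ∧ r < 1 ∧ ‖u‖ ≤ r ∧ ‖v‖ ≤ r :=
  ⟨max ‖u‖ ‖v‖, le_max_of_le_left (norm_nonneg u), max_lt hu hv, le_max_left _ _,
    le_max_right _ _⟩

/-- **`‖F(u, v)‖ ≤ 1`** for `F` integral and `‖u‖, ‖v‖ < 1`. [folklore] -/
theorem norm_padicEval₂_le_one (hF : IsPadicInt F) (hu : ‖u‖ < 1) (hv : ‖v‖ < 1) :
    ‖padicEval₂ F u v‖ ≤ 1 := by
  obtain ⟨F', rfl⟩ := isPadicInt_iff_exists_map.mp hF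
  obtain ⟨u, rfl, hu'⟩ := exists_coe_eq_of_norm_lt_one hu
  obtain ⟨v, rfl, hv'⟩ := exists_coe_eq_of_norm_lt_one hv
  rw [padicEval₂_map F' hu' hv']; exact PadicInt.norm_le_one _

/-- **`‖F(u, v)‖ ≤ max ‖u‖ ‖v‖ < 1`** for `F` integral without constant term. [folklore] -/
theorem norm_padicEval₂_lt_one (hF : IsPadicInt F) (hF0 : MvPowerSeries.constantCoeff F = 0)
    (hu : ‖u‖ < 1) (hv : ‖v‖ < 1) : ‖padicEval₂ F u v‖ < 1 := by
  obtain ⟨r, hr0, hr1, hur, hvr⟩ := exists_radius_lt_one hu hv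
  refine lt_of_le_of_lt ?_ hr1
  unfold padicEval₂
  refine IsUltrametricDist.norm_tsum_le_of_forall_le_of_nonneg hr0 fun d => ?_
  by_cases hd : d = 0
  · subst hd
    rw [MvPowerSeries.coeff_zero_eq_constantCoeff_apply, hF0, zero_mul, norm_zero]
    exact hr0
  · have hdeg : 1 ≤ d 0 + d 1 := by
      by_contra hlt
      apply hd
      have h0 : d 0 = 0 := by omega
      have h1 : d 1 = 0 := by omega
      ext i; fin_cases i <;> simp [h0, h1]
    rw [norm_mul, norm_mul, norm_pow, norm_pow]
    calc ‖MvPowerSeries.coeff d F‖ * (‖u‖ ^ d 0 * ‖v‖ ^ d 1)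
        ≤ 1 * (r ^ d 0 * r ^ d 1) := by gcongr; exact hF d
      _ = r ^ (d 0 + d 1) := by rw [one_mul, pow_add]
      _ ≤ r ^ 1 := pow_le_pow_of_le_one hr0 hr1.le hdeg
      _ = r := pow_one r

/-- `(F + G)(u,v) = F(u,v) + G(u,v)` (integral `F, G`, `‖u‖, ‖v‖ < 1`). [folklore] -/
theorem padicEval₂_add (hF : IsPadicInt F) (hG : IsPadicInt G) (hu : ‖u‖ < 1) (hv : ‖v‖ < 1) :
    padicEval₂ (F + G) u v = padicEval₂ F u v + padicEval₂ G u v := by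
  obtain ⟨F', rfl⟩ := isPadicInt_iff_exists_map.mp hF
  obtain ⟨G', rfl⟩ := isPadicInt_iff_exists_map.mp hG
  obtain ⟨u, rfl, hu'⟩ := exists_coe_eq_of_norm_lt_one hu
  obtain ⟨v, rfl, hv'⟩ := exists_coe_eq_of_norm_lt_one hv
  rw [← map_add, padicEval₂_map _ hu' hv', padicEval₂_map _ hu' hv', padicEval₂_map _ hu' hv',
    map_add, PadicInt.coe_add]

/-- `(-F)(u,v) = -F(u,v)`. [folklore] -/
theorem padicEval₂_neg (hF : IsPadicInt F) (hu : ‖u‖ < 1) (hv : ‖v‖ < 1) :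
    padicEval₂ (-F) u v = -padicEval₂ F u v := by
  obtain ⟨F', rfl⟩ := isPadicInt_iff_exists_map.mp hF
  obtain ⟨u, rfl, hu'⟩ := exists_coe_eq_of_norm_lt_one hu
  obtain ⟨v, rfl, hv'⟩ := exists_coe_eq_of_norm_lt_one hv
  rw [← map_neg, padicEval₂_map _ hu' hv', padicEval₂_map _ hu' hv', map_neg, PadicInt.coe_neg]

/-- `(F - G)(u,v) = F(u,v) - G(u,v)`. [folklore] -/
theorem padicEval₂_sub (hF : IsPadicInt F) (hG : IsPadicInt G) (hu : ‖u‖ < 1) (hv : ‖v‖ < 1) :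
    padicEval₂ (F - G) u v = padicEval₂ F u v - padicEval₂ G u v := by
  rw [sub_eq_add_neg, padicEval₂_add hF hG.neg hu hv, padicEval₂_neg hG hu hv, sub_eq_add_neg]

/-- **`(F G)(u,v) = F(u,v) G(u,v)`** (integral `F, G`, `‖u‖, ‖v‖ < 1`). [folklore] -/
theorem padicEval₂_mul (hF : IsPadicInt F) (hG : IsPadicInt G) (hu : ‖u‖ < 1) (hv : ‖v‖ < 1) :
    padicEval₂ (F * G) u v = padicEval₂ F u v * padicEval₂ G u v := by
  obtain ⟨F', rfl⟩ := isPadicInt_iff_exists_map.mp hF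
  obtain ⟨G', rfl⟩ := isPadicInt_iff_exists_map.mp hG
  obtain ⟨u, rfl, hu'⟩ := exists_coe_eq_of_norm_lt_one hu
  obtain ⟨v, rfl, hv'⟩ := exists_coe_eq_of_norm_lt_one hv
  rw [← map_mul, padicEval₂_map _ hu' hv', padicEval₂_map _ hu' hv', padicEval₂_map _ hu' hv',
    map_mul, PadicInt.coe_mul]

/-- `(Fⁿ)(u,v) = F(u,v)ⁿ`. [folklore] -/
theorem padicEval₂_pow (hF : IsPadicInt F) (hu : ‖u‖ < 1) (hv : ‖v‖ < 1) (n : ℕ) :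
    padicEval₂ (F ^ n) u v = padicEval₂ F u v ^ n := by
  obtain ⟨F', rfl⟩ := isPadicInt_iff_exists_map.mp hF
  obtain ⟨u, rfl, hu'⟩ := exists_coe_eq_of_norm_lt_one hu
  obtain ⟨v, rfl, hv'⟩ := exists_coe_eq_of_norm_lt_one hv
  rw [← map_pow, padicEval₂_map _ hu' hv', padicEval₂_map _ hu' hv', map_pow, PadicInt.coe_pow]

/-- **Evaluation commutes with substitution of a pair into one variable**:
`(f ∘ F)(u, v) = f(F(u, v))` for `f ∈ ℤ_p⟦X⟧`, `F ∈ ℤ_p⟦u, v⟧` without constant term.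
[Bourbaki, Algèbre IV §4 no. 3] [folklore] -/
theorem padicEval₂_subst (hf : IsPadicInt f) (hF : IsPadicInt F)
    (hF0 : MvPowerSeries.constantCoeff F = 0) (hu : ‖u‖ < 1) (hv : ‖v‖ < 1) :
    padicEval₂ (f.subst F) u v = padicEval f (padicEval₂ F u v) := by
  have hFuv : ‖padicEval₂ F u v‖ < 1 := norm_padicEval₂_lt_one hF hF0 hu hv
  obtain ⟨f', rfl⟩ := isPadicInt_iff_exists_powerSeries_map.mp hf
  obtain ⟨F', rfl⟩ := isPadicInt_iff_exists_map.mp hF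
  obtain ⟨u, rfl, hu'⟩ := exists_coe_eq_of_norm_lt_one hu
  obtain ⟨v, rfl, hv'⟩ := exists_coe_eq_of_norm_lt_one hv
  have hF0' : MvPowerSeries.constantCoeff F' = 0 := by
    apply PadicInt.coe_eq_zero.mp
    rw [MvPowerSeries.constantCoeff_map] at hF0
    exact hF0
  have hFs : PowerSeries.HasSubst F' := PowerSeries.HasSubst.of_constantCoeff_zero hF0'
  rw [padicEval₂_map F' hu' hv'] at hFuv ⊢
  rw [← PowerSeries.map_subst hFs, padicEval₂_map _ hu' hv', padicEval_map _ hFuv]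
  simp only [evalHom_apply, evalHom₂_apply]
  congr 1
  exact padicInt_eval₂_powerSeries_subst hFs (padicInt_hasEval_pair hu' hv') f'

/-- In particular a one-variable series read in the variable `Xᵢ` evaluates to `f(u)` resp.
`f(v)`. [folklore] -/
theorem padicEval₂_subst_X (hf : IsPadicInt f) (hu : ‖u‖ < 1) (hv : ‖v‖ < 1) (i : Fin 2) :
    padicEval₂ (f.subst (MvPowerSeries.X i : MvPowerSeries (Fin 2) ℚ_[p])) u v =
      padicEval f (![u, v] i) := by
  rw [padicEval₂_subst hf (IsPadicInt.X i) (MvPowerSeries.constantCoeff_X i) hu hv, padicEval₂_X]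

/-- **Evaluation commutes with substitution of a pair of series**:
`F(A, B)(u, v) = F(A(u,v), B(u,v))` for `F, A, B ∈ ℤ_p⟦u, v⟧`, `A(0,0) = B(0,0) = 0`.
[Bourbaki, Algèbre IV §4 no. 3] [folklore] -/
theorem padicEval₂_substPair {A B : MvPowerSeries (Fin 2) ℚ_[p]} (hF : IsPadicInt F)
    (hA : IsPadicInt A) (hB : IsPadicInt B) (hA0 : MvPowerSeries.constantCoeff A = 0)
    (hB0 : MvPowerSeries.constantCoeff B = 0) (hu : ‖u‖ < 1) (hv : ‖v‖ < 1) :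
    padicEval₂ (MvPowerSeries.subst ![A, B] F) u v =
      padicEval₂ F (padicEval₂ A u v) (padicEval₂ B u v) := by
  have hAuv : ‖padicEval₂ A u v‖ < 1 := norm_padicEval₂_lt_one hA hA0 hu hv
  have hBuv : ‖padicEval₂ B u v‖ < 1 := norm_padicEval₂_lt_one hB hB0 hu hv
  obtain ⟨F', rfl⟩ := isPadicInt_iff_exists_map.mp hF
  obtain ⟨A', rfl⟩ := isPadicInt_iff_exists_map.mp hA
  obtain ⟨B', rfl⟩ := isPadicInt_iff_exists_map.mp hB
  obtain ⟨u, rfl, hu'⟩ := exists_coe_eq_of_norm_lt_one hu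
  obtain ⟨v, rfl, hv'⟩ := exists_coe_eq_of_norm_lt_one hv
  have hA0' : MvPowerSeries.constantCoeff A' = 0 := by
    apply PadicInt.coe_eq_zero.mp
    rw [MvPowerSeries.constantCoeff_map] at hA0
    exact hA0
  have hB0' : MvPowerSeries.constantCoeff B' = 0 := by
    apply PadicInt.coe_eq_zero.mp
    rw [MvPowerSeries.constantCoeff_map] at hB0
    exact hB0
  have hs : MvPowerSeries.HasSubst ![A', B'] :=
    MvPowerSeries.hasSubst_of_constantCoeff_zero fun i => by fin_cases i <;> assumption
  have hmap : (![A'.map PadicInt.Coe.ringHom, B'.map PadicInt.Coe.ringHom] :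
      Fin 2 → MvPowerSeries (Fin 2) ℚ_[p]) = fun i => (![A', B'] i).map PadicInt.Coe.ringHom := by
    funext i; fin_cases i <;> rfl
  rw [padicEval₂_map A' hu' hv'] at hAuv ⊢
  rw [padicEval₂_map B' hu' hv'] at hBuv ⊢
  rw [hmap, ← MvPowerSeries.map_subst hs, padicEval₂_map _ hu' hv', padicEval₂_map F' hAuv hBuv,
    evalHom₂_apply, evalHom₂_apply, padicInt_eval₂_subst hs (padicInt_hasEval_pair hu' hv')]
  congr 2
  funext s; fin_cases s <;> simp [evalHom₂_apply]

end TwoVar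

end Eval

end Literature.NumberTheory.EllipticCurves
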